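import Summits.AtomisticToContinuum.HydrodynamicLimit.Theorems.LambertianContactSwapLambertianEulerLiouvilleOfWindow
import Mathlib.MeasureTheory.Integral.IntervalIntegral.Basic
import HarnessLib

/-!
# The window cocycle: pathwise restart of windowed jump sums, counts and time integrals of the
# Lambertian flow (tool `WindowCocycle` of line `Sketch`, crux stmt-AtomisticToContinuum-11854, lead c8)

Support file (`--supports stmt-AtomisticToContinuum-11854`).  Purely pathwise bookkeeping for the
Lambertian hard-sphere recursion of `Literature.MathematicalPhysics.KineticTheory.LambertianHardSphereFlow`
(any geometry `G`, any diameter `ε`, a fixed noise sequence `ξs` and datum `z`): write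
`z_m = lambertStateAfter`, `t_m = lambertInstant ∈ [0, ∞]`, `K_u = lambertCount`, `Λ_u = lambertFlow`, and
RESTART at a time `a ≥ 0`: `w := Λ_a`, shifted noise `ηs := ξs (· + K_a)`, primed objects those of `(w, ηs)`.
Off the accumulation (Zeno) set — some instant passes beyond `a + h` — the restart kit
`…LambertianWellPosedRestart/Regular` (namespace `LRestart`: collision segments, restart of states,
instants, count and flow) and the flow cocycle `…LambertianEulerLiouvilleOfWindow.lambertFlow_add_eq_restart`
assemble into the re-indexing identities the collisional heart needs for its clamped window functional:

* `exitCfg_freeFlight` (C1): the exit configuration `S_{τ(w)} w` is the same from every point of the first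
  free flight (`Alexander.freeFlight_freeExitTime_freeFlight`);
* `count_window_eq_restart` (C3): `K_{a+h} = K_a + K'_h`;
* `jumpSum_window_eq_restart` (C2, main): for a jump functional `F(t, ·)` that is constant along the open
  first free flight of its argument (it reads a state only through its exit configuration),
  `Σ_{m<K_{a+h}} 1{a < t_{m+1}} F(t_{m+1}, z_m) = Σ_{m<K'_h} 1{0 < t'_{m+1}} F(a + t'_{m+1}, z'_m)`:
  split the left sum at `k = K_a` (`Finset.sum_range_add`); the terms `m < k` vanish (`t_{m+1} ≤ t_k ≤ a`);
  for `m = k + m'`, `t_{k+m'+1} = a + t'_{m'+1}` (`LRestart.lambertInstant_lambertFlow_succ_add`),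
  `z_{k+m'} = z'_{m'}` for `m' ≥ 1` (`LRestart.lambertStateAfter_lambertFlow_succ`) and for `m' = 0`
  `z'_0 = Λ_a = S_{a - t_k} z_k` with `a - t_k < τ(z_k)` so the hypothesis on `F` applies; both indicators
  are on (`t_{k+1} > a`, `t'_1 = t_{k+1} - a > 0`);
* `intervalIntegral_window_eq_restart` (C4): `∫_a^{a+h} Gf(r, Λ_r) dr = ∫_0^h Gf(a + r, Λ'_r) dr`
  (shift, then `intervalIntegral.integral_congr` with the flow cocycle pointwise; no integrability needed).

No measure theory beyond the Lebesgue interval integral of C4; no definitions.  All [folklore].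
-/

noncomputable section

open scoped BigOperators Topology ENNReal
open MeasureTheory Filter Set
open Literature.MathematicalPhysics.KineticTheory
open Literature.Analysis.FluidPDE Literature.Analysis.FluidPDE.Alexander

namespace Summit.AtomisticToContinuum.HydrodynamicLimit.Theorems.LambertianContactSwapLambertianEulerWindowCocycle

open Summit.AtomisticToContinuum.HydrodynamicLimit.Theorems.LambertianContactSwapLambertianEulerLiouvilleOfWindow

/-! ## C1. The exit configuration along the first free flight -/

/-- **C1. The exit configuration is constant along the first free flight**: for `0 ≤ u ≤ τ(w) < ∞`,
`S_{τ(S_u w)} (S_u w) = S_{τ(w)} w` (`Alexander.freeFlight_freeExitTime_freeFlight`: `τ(S_u w) + u = τ(w)`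
and free flight is a one-parameter group). [folklore] -/
theorem exitCfg_freeFlight : ∀ {d : Type*} [Fintype d] {X : Type*} {N : ℕ} {G : Geometry d X} {ε : ℝ}
    {w : Config N d X} {u : ℝ}, 0 ≤ u → ENNReal.ofReal u ≤ freeExitTime G ε w → freeExitTime G ε w ≠ ⊤ →
    freeFlight G (freeExitTime G ε (freeFlight G u w)).toReal (freeFlight G u w) =
      freeFlight G (freeExitTime G ε w).toReal w := by
  intro d _ X N G ε w u hu h hτ
  exact freeFlight_freeExitTime_freeFlight hu h hτ

/-! ## C3. The count over a window -/

/-- **C3. Restart of the collision count over a window**: off the accumulation set at `a` and at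
`a + h` (`a, h ≥ 0`), `K_{a+h}(z; ξs) = K_a(z; ξs) + K_h(Λ_a(z; ξs); ξs (· + K_a(z; ξs)))` — the collisions
in `(a, a + h]` are those of the restarted pair in `(0, h]` (`LRestart.exists_lambert_segment` twice, the
restarted one through `exists_lt_lambertInstant_restart`, and `LRestart.lambertCount_add_of_segment`).
[folklore] -/
theorem count_window_eq_restart : ∀ {d : Type*} [Fintype d] {X : Type*} {N : ℕ} {G : Geometry d X} {ε : ℝ}
    {ξs : ℕ → EuclideanSpace ℝ d} {z : Config N d X} {a h : ℝ}, 0 ≤ a → 0 ≤ h →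
    (∃ k, ENNReal.ofReal a < lambertInstant G ε ξs z k) →
    (∃ k, ENNReal.ofReal (a + h) < lambertInstant G ε ξs z k) →
    lambertCount G ε ξs z (a + h) = lambertCount G ε ξs z a +
      lambertCount G ε (fun n => ξs (n + lambertCount G ε ξs z a)) (lambertFlow G ε ξs z a) h := by
  intro d _ X N G ε ξs z a h ha hh hA hAH
  obtain ⟨k, h1, h2⟩ := LRestart.exists_lambert_segment hA le_rfl
  obtain ⟨m, h1', h2'⟩ :=
    LRestart.exists_lambert_segment (exists_lt_lambertInstant_restart ha hh h1 h2 hAH) le_rfl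
  rw [lambertCount_eq_of_segment h1 h2, lambertCount_eq_of_segment h1' h2']
  exact LRestart.lambertCount_add_of_segment ha hh h1 h2 h1' h2'

/-! ## C2. Windowed jump sums -/

/-- **C2. Restart of windowed jump sums (the window cocycle)**: let `F(t, ·)` be constant along the
open first free flight of its argument (`F t (S_u w) = F t w` for `0 ≤ u < τ(w) < ∞` — e.g. any function
of the exit configuration `S_{τ(w)} w`, by C1). Off the accumulation set at `a` and at `a + h`
(`a, h ≥ 0`), with `w := Λ_a(z; ξs)`, `ηs := ξs (· + K_a)` and primes for the pair `(w, ηs)`: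
`Σ_{m < K_{a+h}} 1{a < t_{m+1}} F(t_{m+1}, z_m) = Σ_{m < K'_h} 1{0 < t'_{m+1}} F(a + t'_{m+1}, z'_m)`.
With `k = K_a` (`t_k ≤ a < t_{k+1}`): `K_{a+h} = k + K'_h` (C3); the terms `m < k` on the left vanish
(`t_{m+1} ≤ t_k ≤ a`); for `m = k + m'`: `t_{k+m'+1} = t'_{m'+1} + a`
(`LRestart.lambertInstant_lambertFlow_succ_add`, finite below `t'_{K'_h} ≤ h`), `z_{k+m'} = z'_{m'}` for
`m' ≥ 1` (`LRestart.lambertStateAfter_lambertFlow_succ`), and for `m' = 0`, `z'_0 = Λ_a = S_{a - t_k} z_k`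
with `0 ≤ a - t_k < τ(z_k) < ∞`, where the hypothesis on `F` applies; both indicators are on since
`t'_1 + a = t_{k+1} > a`. [folklore] -/
theorem jumpSum_window_eq_restart : ∀ {d : Type*} [Fintype d] {X : Type*} {N : ℕ} {G : Geometry d X} {ε : ℝ}
    (F : ℝ → Config N d X → ℝ),
    (∀ (t : ℝ) (w : Config N d X) (u : ℝ), 0 ≤ u → ENNReal.ofReal u < freeExitTime G ε w →
      freeExitTime G ε w ≠ ⊤ → F t (freeFlight G u w) = F t w) →
    ∀ {ξs : ℕ → EuclideanSpace ℝ d} {z : Config N d X} {a h : ℝ}, 0 ≤ a → 0 ≤ h →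
    (∃ k, ENNReal.ofReal a < lambertInstant G ε ξs z k) →
    (∃ k, ENNReal.ofReal (a + h) < lambertInstant G ε ξs z k) →
    (∑ m ∈ Finset.range (lambertCount G ε ξs z (a + h)),
        if a < (lambertInstant G ε ξs z (m + 1)).toReal then
          F (lambertInstant G ε ξs z (m + 1)).toReal (lambertStateAfter G ε ξs z m) else 0) =
      ∑ m ∈ Finset.range (lambertCount G ε (fun n => ξs (n + lambertCount G ε ξs z a)) (lambertFlow G ε ξs z a) h),
        if 0 < (lambertInstant G ε (fun n => ξs (n + lambertCount G ε ξs z a)) (lambertFlow G ε ξs z a) (m + 1)).toReal then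
          F (a + (lambertInstant G ε (fun n => ξs (n + lambertCount G ε ξs z a)) (lambertFlow G ε ξs z a) (m + 1)).toReal)
            (lambertStateAfter G ε (fun n => ξs (n + lambertCount G ε ξs z a)) (lambertFlow G ε ξs z a) m) else 0 := by
  intro d _ X N G ε F hF ξs z a h ha hh hA hAH
  -- the collision segment `t_k ≤ a < t_{k+1}` of `a`, and the segment of `h` for the restarted pair
  obtain ⟨k, h1, h2⟩ := LRestart.exists_lambert_segment hA le_rfl
  obtain ⟨m₀, h1', h2'⟩ :=
    LRestart.exists_lambert_segment (exists_lt_lambertInstant_restart ha hh h1 h2 hAH) le_rfl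
  have h2s := h2
  rw [lambertInstant_succ] at h2s
  obtain ⟨-, hle, hlt, -⟩ := LRestart.segment_arith' ha h1 h2s
  -- `t'_1 + a = t_{k+1} > a`, so `t'_1 > 0`
  have h0 : lambertInstant G ε (fun n => ξs (n + k)) (lambertFlow G ε ξs z a) 1 + ENNReal.ofReal a =
      lambertInstant G ε ξs z (k + 1) :=
    LRestart.lambertInstant_lambertFlow_succ_add ha h1 h2 0
  have hpos1 : 0 < lambertInstant G ε (fun n => ξs (n + k)) (lambertFlow G ε ξs z a) 1 := by
    refine pos_iff_ne_zero.2 fun hz => ?_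
    rw [hz, zero_add] at h0
    rw [← h0] at h2
    exact lt_irrefl _ h2
  -- the terms `m < k` of the left sum vanish
  have hvan : ∑ m ∈ Finset.range k, (if a < (lambertInstant G ε ξs z (m + 1)).toReal then
      F (lambertInstant G ε ξs z (m + 1)).toReal (lambertStateAfter G ε ξs z m) else 0) = 0 := by
    refine Finset.sum_eq_zero fun m hm => if_neg (not_lt.2 ?_)
    have hle' : lambertInstant G ε ξs z (m + 1) ≤ ENNReal.ofReal a :=
      (monotone_lambertInstant ξs z (Nat.succ_le_of_lt (Finset.mem_range.1 hm))).trans h1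
    have := ENNReal.toReal_mono ENNReal.ofReal_ne_top hle'
    rwa [ENNReal.toReal_ofReal ha] at this
  rw [lambertCount_eq_of_segment h1 h2, LRestart.lambertCount_add_of_segment ha hh h1 h2 h1' h2',
    lambertCount_eq_of_segment h1' h2', Finset.sum_range_add, hvan, zero_add]
  -- termwise comparison for `m = k + m'`, `m' < K'_h`
  refine Finset.sum_congr rfl fun m hm => ?_
  have hm' : m + 1 ≤ m₀ := Nat.succ_le_of_lt (Finset.mem_range.1 hm)
  have hfin' : lambertInstant G ε (fun n => ξs (n + k)) (lambertFlow G ε ξs z a) (m + 1) ≠ ∞ :=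
    ne_top_of_le_ne_top ENNReal.ofReal_ne_top ((monotone_lambertInstant _ _ hm').trans h1')
  have hfin1 : lambertInstant G ε (fun n => ξs (n + k)) (lambertFlow G ε ξs z a) 1 ≠ ∞ :=
    ne_top_of_le_ne_top hfin' (monotone_lambertInstant _ _ (Nat.le_add_left 1 m))
  -- `τ(z_k) < ∞` (else `t_{k+1} = ∞`, but `t_{k+1} = t'_1 + a < ∞`)
  have hτk : freeExitTime G ε (lambertStateAfter G ε ξs z k) ≠ ∞ := by
    intro htop
    have hk1 : lambertInstant G ε ξs z (k + 1) ≠ ∞ := by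
      rw [← h0]
      exact ENNReal.add_ne_top.2 ⟨hfin1, ENNReal.ofReal_ne_top⟩
    rw [lambertInstant_succ, htop, add_top] at hk1
    exact hk1 rfl
  have hne0 : lambertInstant G ε (fun n => ξs (n + k)) (lambertFlow G ε ξs z a) (m + 1) ≠ 0 :=
    (hpos1.trans_le (monotone_lambertInstant _ _ (Nat.le_add_left 1 m))).ne'
  have hinst := LRestart.lambertInstant_lambertFlow_succ_add ha h1 h2 m
  have htR : (lambertInstant G ε ξs z (k + (m + 1))).toReal =
      (lambertInstant G ε (fun n => ξs (n + k)) (lambertFlow G ε ξs z a) (m + 1)).toReal + a := by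
    rw [← hinst, ENNReal.toReal_add hfin' ENNReal.ofReal_ne_top, ENNReal.toReal_ofReal ha]
  have hposR : 0 < (lambertInstant G ε (fun n => ξs (n + k)) (lambertFlow G ε ξs z a) (m + 1)).toReal :=
    ENNReal.toReal_pos hne0 hfin'
  rw [show k + m + 1 = k + (m + 1) from rfl, htR, if_pos (by linarith), if_pos hposR, add_comm _ a]
  -- the states: `z'_0 = Λ_a = S_{a - t_k} z_k` (hypothesis on `F`), `z'_{m'+1} = z_{k+m'+1}`
  rcases m with _ | m
  · rw [Nat.add_zero k, lambertStateAfter_zero, lambertFlow_eq_of_segment h1 h2,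
      hF _ _ _ (sub_nonneg.2 hle) hlt hτk]
  · rw [LRestart.lambertStateAfter_lambertFlow_succ ha h1 h2 hτk m]

/-! ## C4. Window time integrals -/

/-- **C4. Restart of window time integrals of the flow**: off the accumulation set at `a + h`
(`a, h ≥ 0`), for every `Gf : ℝ → Config → ℝ`,
`∫_a^{a+h} Gf(r, Λ_r(z; ξs)) dr = ∫_0^h Gf(a + r, Λ_r(Λ_a(z; ξs); ξs (· + K_a))) dr`: shift the variable
(`intervalIntegral.integral_comp_add_left`) and use the flow cocycle `lambertFlow_add_eq_restart` pointwise
in `r ∈ [0, h]` (`intervalIntegral.integral_congr`; its non-accumulation hypotheses at `a` and `a + r`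
follow from the one at `a + h` by monotonicity). No integrability is needed. [folklore] -/
theorem intervalIntegral_window_eq_restart : ∀ {d : Type*} [Fintype d] {X : Type*} {N : ℕ} {G : Geometry d X}
    {ε : ℝ} (Gf : ℝ → Config N d X → ℝ) {ξs : ℕ → EuclideanSpace ℝ d} {z : Config N d X} {a h : ℝ},
    0 ≤ a → 0 ≤ h → (∃ k, ENNReal.ofReal (a + h) < lambertInstant G ε ξs z k) →
    ∫ r in a..(a + h), Gf r (lambertFlow G ε ξs z r) =
      ∫ r in (0:ℝ)..h, Gf (a + r)
        (lambertFlow G ε (fun n => ξs (n + lambertCount G ε ξs z a)) (lambertFlow G ε ξs z a) r) := by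
  intro d _ X N G ε Gf ξs z a h ha hh hAH
  have hshift := intervalIntegral.integral_comp_add_left (fun r => Gf r (lambertFlow G ε ξs z r)) a
    (a := 0) (b := h)
  rw [add_zero] at hshift
  rw [← hshift]
  refine intervalIntegral.integral_congr fun r hr => ?_
  rw [Set.uIcc_of_le hh] at hr
  have hS : ∃ k, ENNReal.ofReal a < lambertInstant G ε ξs z k :=
    hAH.imp fun k hk => (ENNReal.ofReal_le_ofReal (by linarith)).trans_lt hk
  have hSU : ∃ k, ENNReal.ofReal (a + r) < lambertInstant G ε ξs z k :=
    hAH.imp fun k hk => (ENNReal.ofReal_le_ofReal (by linarith [hr.2])).trans_lt hk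
  rw [lambertFlow_add_eq_restart ha hr.1 hS hSU]

end Summit.AtomisticToContinuum.HydrodynamicLimit.Theorems.LambertianContactSwapLambertianEulerWindowCocycle

end
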